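import Summits.AtomisticToContinuum.Crystallization.Theorems.FrustratedLawDichotomyStrainedPatchHomEntryLeafHTA2QExists

/-!
# The SQUARED centred pair test (kit): `cPairOKRS`, the verdict `fitOKHDCRS`, the inner verdict `entryLeafOKHQDCRS`, the slab leaf `entryLeafOKHT4A2QQDCRS`
# and the production verdict `entryLeafOKHT4A2QQDCRSE` (27623 `(H) HomFloor (1/625)`, hcp half; hand-1 g36; critic rows 1331 (2c) / 1337 «the 2⁻⁹ bulk cell»)

decomp-a2c hand-1 g36 (crux `AperiodicFrustratedLawGap`, stmt-AtomisticToContinuum-27623).  DIAGNOSIS (hand-1 g36, seat probe Q1 + float model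
`k2probe.py`): the inner (P1) fit verdict of record `…CentredRotKit.fitOKHDCR` bounds the pair misfit `‖r_c + Δ‖` by the LINEARISED norm
`‖r_c‖ + ⟪ê, Δ⟫ + (ρ_k + ρ_{k′})²/(2(‖r_c‖ − ρ_k − ρ_{k′}))` (`…CentredReal.pairResidual_le`), whose remainder is singular as the box-variation norm bound
`ρ_k + ρ_{k′}` approaches the centre misfit `‖r_c‖ ≈ 0.025`: on the `2⁻⁹` bulk cell's hull leaf (`ξ` half-widths `(5.0, 5.9, 1.3)e-3`) `ρ_k + ρ_{k′} ≈ 0.024` and the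
verdict falls back to the triangle bound and FAILS, although the exact first-order budget has margin `+1.06e-2` of `2.31e-2` (float).  The SQUARED form
`‖r_c + Δ‖² = ‖r_c‖² + 2⟪r_c, Δ⟫ + ‖Δ‖² ≤ ‖r_c‖² + 2‖r_c‖(T + q₁) + (ρ_k + ρ_{k′})²` (same exact first-order functional `T = cTU + cTX`, same `q₁`, NO singular
remainder; it dominates the linearised bound for every box since `(A + T + P²/(2(A−P)))² ≥ A² + 2AT + P²`) is tested directly against `(4999/100000)²·d²`.
KERNEL (seat probe Q1, `#eval`): at `cB065`, entries `2⁻⁹` × `ξ (5.0, 5.9, 1.3)e-3` (the FULL hull leaf of the `2⁻⁹` cell): `fitOKHDCR = false`, ★ `fitOKHDCRS = true`;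
entries `2⁻⁹` × `ξ (6.0, 7.0, 2.0)e-3`: false; entries `2⁻⁸` × `ξ (10, 12, 2.6)e-3`: false (pairs `(2…5, 6…11)` over budget).

* §1 `cPairCoreRS` / `cPairCRS` (the squared centred bound from the SAME direction data and box enclosures as `cPairCoreR`), `cTestSq`, `cPairOKRS`, ★ `fitOKHDCRS`;
* §2 the inner verdict `entryLeafOKHQDCRS μ q := fitOKHDCRS ∨ fitOKHDM ∨ entryLeafOKHQ μ` (symmetrised box), the slab leaf `entryLeafOKHT4A2QQDCRS` (= `entryLeafOKHT4A2Q`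
  with that inner verdict) and the production verdict `entryLeafOKHT4A2QQDCRSE μ := decide (∃ payloads, entryLeafOKHT4A2QQDCRS …) ∨ entryLeafOKHT4A2QQDCRE μ`
  (CONTAINS the production verdict of record `…HTA2QExists.entryLeafOKHT4A2QQDCRE`: every landed cell and tree stays valid).
Soundness: `…CentredRealSq` (real side), `…CentredRotSqPair`, `…CentredRotSqSound`, `…HTA2QSq`.

All definitions computable except the classical production verdict; 0 sorry; standard axioms; no instances / notation / `#eval`.  `--supports stmt-AtomisticToContinuum-27623`.
-/

namespace Summit.AtomisticToContinuum.Crystallization.Theorems.FrustratedLawDichotomyStrainedPatchHomEntryFitHcpCentred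

open Literature.Analysis.ValidatedNumerics.Numerics
open Summit.AtomisticToContinuum.Crystallization.Theorems.FrustratedLawDichotomyStrainedPatchHomEntryGramHcp (dot3 shufFI)
open Summit.AtomisticToContinuum.Crystallization.Theorems.FrustratedLawDichotomyStrainedPatchHomEntryFit (scaleL devFI lmax)
open Summit.AtomisticToContinuum.Crystallization.Theorems.FrustratedLawDichotomyStrainedPatchHomEntryFitKit (lmin)
open Summit.AtomisticToContinuum.Crystallization.Theorems.FrustratedLawDichotomyStrainedPatchHomEntryHcpFrame (hlab hshift nbr)
open Summit.AtomisticToContinuum.Crystallization.Theorems.FrustratedLawDichotomyStrainedPatchHomEntryFitHcpKit (dEnclH nbrSq xiSq box7all qform13 extU K12H)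
open Summit.AtomisticToContinuum.Crystallization.Theorems.FrustratedLawDichotomyStrainedPatchHomEntryFitHcpSharpKit (nbrFI rVec nrm2 dlt devH d2S)
open Summit.AtomisticToContinuum.Crystallization.Theorems.FrustratedLawDichotomyStrainedPatchHomEntrySymBox (symH)
open Summit.AtomisticToContinuum.Crystallization.Theorems.FrustratedLawDichotomyStrainedPatchHomEntryQuickHcp (entryLeafOKHQ)

/-! ## §1. The squared centred pair bound and the verdict -/

/-- ★ The SQUARED centred pair bound from direction data `e ∋ ê`, `g ∋ ĝ` against the rotated pattern: an enclosure of
`‖r_c‖² + 2‖r_c‖·(T + q₁) + (ρ_k + ρ_{k′})²` (`T = cTU + cTX`, `q₁ = |⟪ê, Q n_k⟫|·ρ_{k′}²/(2(‖N_c‖ − ρ_{k′}))`; none if the `q₁` guard fails). -/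
def cPairCoreRS (c w : (Fin 3 × Fin 3) ⊕ Fin 3 → ℤ) (L : ℤ) (q : Fin 4 → ℤ) (k k' : Fin 12) (e g : Fin 3 → FI) : Option FI :=
  (FI.divPos ((absFI (dot3 e (qnFI q k))).mul (cRho c w k').sqr) (((cNcN c L k').sub (cRho c w k')).mulInt 2)).bind fun q1 =>
    some (((cRcNR c L q k k').sqr).add
      ((((cRcNR c L q k k').mul ((((cTU c w k k' e g (dot3 e (qnFI q k))).add (cTX c w k k' e g (dot3 e (qnFI q k)))).add q1))).mulInt 2).add
        (((cRho c w k).add (cRho c w k')).sqr)))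

/-- The squared centred rotated pair bound (none if `‖r_c‖` or `‖N_c‖` is not certainly positive or the guard fails). -/
def cPairCRS (c w : (Fin 3 × Fin 3) ⊕ Fin 3 → ℤ) (L : ℤ) (q : Fin 4 → ℤ) (k k' : Fin 12) : Option FI :=
  (vec3? (cEhR c L q k k')).bind fun e => (vec3? (cGh c L k')).bind fun g => cPairCoreRS c w L q k k' e g

/-- The squared pair test of a scaled bound `B2` of the SQUARED misfit (`‖r‖²·SC ≤ B2`) at threshold `η′ = 4999/100000`: `10¹⁰·B2 ≤ 24990001·d2S`. -/
def cTestSq (d2 B2 : ℤ) : Bool := decide (10000000000 * B2 ≤ 24990001 * d2)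

/-- The squared rotated pair test: the triangle bound passes, or the squared centred bound exists and passes. -/
def cPairOKRS (c w : (Fin 3 × Fin 3) ⊕ Fin 3 → ℤ) (L : ℤ) (q : Fin 4 → ℤ) (k k' : Fin 12) : Bool :=
  cTest (d2S c w L) (cPairTR c w L q k k') || (cPairCRS c w L q k k').elim false fun B => cTestSq (d2S c w L) B.hi

/-- ★ **THE CENTRED hcp (P1) FIT VERDICT WITH THE ROTATION PAYLOAD AND THE SQUARED PAIR TEST** (`…CentredRotKit.fitOKHDCR` with `cPairOKRS`). -/
def fitOKHDCRS (c w : (Fin 3 × Fin 3) ⊕ Fin 3 → ℤ) (q : Fin 4 → ℤ) : Bool :=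
  let L := scaleL (fun ab => c (Sum.inl ab))
  let D := dEnclH c w
  decide (c (Sum.inl (1, 0)) = c (Sum.inl (0, 1)) ∧ c (Sum.inl (2, 0)) = c (Sum.inl (0, 2)) ∧ c (Sum.inl (2, 1)) = c (Sum.inl (1, 2))) &&
  decide (0 ≤ L) && decide (0 < D.lo) && decide (D.lo ≤ D.hi) && decide (2 * D.hi ≤ 3 * (SC : ℤ)) &&
  decide ((SC : ℤ) ≤ 130 * D.lo) && decide (4 * (xiSq c w).hi ≤ (SC : ℤ)) &&
  decide (0 < cayN q) && K12H.all (fun k => K12H.all fun k' => !possMinH c w k' || cPairOKRS c w L q k k') &&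
  K12H.all (fun k => decide ((nbrSq c w k).hi * SC * 10000 ≤ (130 * D.lo - SC) ^ 2)) &&
  decide (∀ b ∈ box7all,
    (b = 0 ∨ (∃ k : Fin 12, hshift k = false ∧ hlab k = b) ∨ (130 * D.hi + (SC : ℤ)) ^ 2 ≤ (qform13 (extU c w) b false).lo * SC * 10000) ∧
    ((∃ k : Fin 12, hshift k = true ∧ hlab k = b) ∨ (130 * D.hi + (SC : ℤ)) ^ 2 ≤ (qform13 (extU c w) b true).lo * SC * 10000))

/-! ## §2. The inner verdict, the slab leaf and the production verdict -/

/-- ★ **hcp INNER VERDICT WITH THE SQUARED PAIR TEST**: `fitOKHDCRS … q` on the symmetrised box, else the min-pairs centred fit `fitOKHDM`, else the quick verdict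
of record `entryLeafOKHQ μ`. -/
def entryLeafOKHQDCRS (μ : ℤ) (q : Fin 4 → ℤ) (c w : (Fin 3 × Fin 3) ⊕ Fin 3 → ℤ) : Bool :=
  fitOKHDCRS (symH c) (symH w) q || fitOKHDM (symH c) (symH w) || entryLeafOKHQ μ c w

end Summit.AtomisticToContinuum.Crystallization.Theorems.FrustratedLawDichotomyStrainedPatchHomEntryFitHcpCentred

namespace Summit.AtomisticToContinuum.Crystallization.Theorems.FrustratedLawDichotomyStrainedPatchHomEntryLeafHT

open Literature.Analysis.ValidatedNumerics.Numerics
open Summit.AtomisticToContinuum.Crystallization.Theorems.FrustratedLawDichotomyStrainedPatchHomCertTree (CertTree treeOK)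
open Summit.AtomisticToContinuum.Crystallization.Theorems.FrustratedLawDichotomyStrainedPatchHomEntryFitHcpCentred (entryLeafOKHQDCRS)

/-- ★ The affine-reference slab leaf with the SQUARED-test inner verdict `entryLeafOKHQDCRS μ q` on the sheet-tracked box. -/
def entryLeafOKHT4A2QQDCRS (μ : ℤ) (q : Fin 4 → ℤ) (p : HTCert) (Q : Fin 3 → ℤ) (Gn : ℤ) (J : Fin 3 → Fin 3 × Fin 3 → ℤ)
    (t : CertTree ((Fin 3 × Fin 3) ⊕ Fin 3)) (c w : (Fin 3 × Fin 3) ⊕ Fin 3 → ℤ) : Bool :=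
  entryLeafOKHT4A2Q (entryLeafOKHQDCRS μ q) p Q Gn J t c w

/-- ★ **THE PRODUCTION LEAF VERDICT, v2**: some payload passes the squared-test slab leaf, else the production verdict of record `entryLeafOKHT4A2QQDCRE μ`
(CONTAINMENT by construction; classical `decide`, never evaluated by the kernel). -/
noncomputable def entryLeafOKHT4A2QQDCRSE (μ : ℤ) (c w : (Fin 3 × Fin 3) ⊕ Fin 3 → ℤ) : Bool :=
  @decide (∃ (q : Fin 4 → ℤ) (p : HTCert) (Q : Fin 3 → ℤ) (Gn : ℤ) (J : Fin 3 → Fin 3 × Fin 3 → ℤ) (t : CertTree ((Fin 3 × Fin 3) ⊕ Fin 3)),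
      entryLeafOKHT4A2QQDCRS μ q p Q Gn J t c w = true) (Classical.propDecidable _) || entryLeafOKHT4A2QQDCRE μ c w

end Summit.AtomisticToContinuum.Crystallization.Theorems.FrustratedLawDichotomyStrainedPatchHomEntryLeafHT
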